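import Mathlib
import Summits.ValiantsHypothesis.ValiantsHypothesis.Theses.LacunarySymmetroid
import Summits.ValiantsHypothesis.ValiantsHypothesis.Theorems.LacunarySymmetroidMatrixDescartesCensusRealExponentsDoors
import Summits.ValiantsHypothesis.ValiantsHypothesis.Theorems.LacunarySymmetroidMatrixDescartesCensusRealExponentsAllSizes
import Summits.ValiantsHypothesis.ValiantsHypothesis.Theorems.LacunarySymmetroidDoorA26ExtremalInverseDefs
import Summits.ValiantsHypothesis.ValiantsHypothesis.Theorems.LacunarySymmetroidDoorA26ExtremalInverseStubPrescribedToPencil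

/-!
# Route `LacunarySymmetroid` — crux `DoorA26` (stmt-ValiantsHypothesis-19979), line «inverse-door» (negation face):
# the compositions `PrescribedWitness 20 → ¬ DoorA26` and `PrescribedWitness 19 → ¬ PosRootLawAt 2 6 18`, Theorems side

Line `Cruxes/DoorA26/Lines/inverse_door.lean` (ideator val-idea-4 g2) composes the NEGATION of the door from a twenty-root
prescribed witness (`stub_witness20`, a SEARCH TARGET, open) and the register `ζ_sym(2,6) ≥ 19` from a nineteen-root witness
(`stub_witness19`, open), both through the support stub `stub_prescribedToPencil` — LANDED
(`…DoorA26ExtremalInverseStubPrescribedToPencil`, p597809).  This file carries the two compositions to the Theorems side as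
unconditional implications, so that whoever produces a `PrescribedWitness 20` (resp. `19`) — a nonzero symmetroid Gram
`v vᵀ − u uᵀ − w wᵀ` on a Sidon REAL support vanishing at twenty (resp. nineteen) prescribed positive points — refutes the door
(resp. settles the register) by ONE lemma:

* `not_doorA26_of_prescribedWitness` — `PrescribedWitness 20 → ¬ Summit.….Theses.LacunarySymmetroid.DoorA26`
  (`stub_prescribedToPencil` + the in-tree real-exponent transfer `Census.RealExp.theses_doorA26_iff_rpow`);
* `not_posRootLawAt_2_6_18_of_prescribedWitness` — `PrescribedWitness 19 → ¬ PosRootLawAt 2 6 18`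
  (`Census.RealExp.not_posRootLawAt_iff_all`);
* `prescribedWitness_mono` — monotonicity in the number of prescribed roots (verbatim from the line file).

HONEST FRAMING.  No witness is constructed here: `stub_witness20` / `stub_witness19` are OPEN search targets (the extremal-inverse
face's evidence — 0 of 8 034 sampled would-be Grams with `n₊ ≤ 1` — suggests the twenty-root target is EMPTY, i.e. `DoorA26` true);
`DoorA26` stays OPEN and is neither proved nor refuted; nothing bears on `MatrixDescartes` (stmt-ValiantsHypothesis-18050), Conjecture B
or `VP ≠ VNP`.  Closes no item (`--supports stmt-ValiantsHypothesis-19979`, helper).  Width seat val-width-19979-ei1, 2026-08-28.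
[folklore]
-/

-- `Summit.ValiantsHypothesis.ValiantsHypothesis.…` repeats a component by the D-0017 layout
-- (single-conjunct summit), which the `dupNamespace` linter flags; the name is mandated.
set_option linter.dupNamespace false

namespace Summit.ValiantsHypothesis.ValiantsHypothesis.Theorems.LacunarySymmetroid.DoorA26.InverseDoor

open Matrix Finset
open scoped BigOperators
open Summit.ValiantsHypothesis.ValiantsHypothesis.Theorems.MatrixDescartes.Negative (PosRootLawAt)
open Summit.ValiantsHypothesis.ValiantsHypothesis.Theorems.LacunarySymmetroidMatrixDescartes.Census.RealExp
  (theses_doorA26_iff_rpow not_posRootLawAt_iff_all)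

/-- **Negation face, composition 1: a twenty-root prescribed witness refutes the door.**  If some nonzero symmetroid Gram on a
Sidon real support vanishes at twenty prescribed positive points, then `¬ DoorA26` (the symmetric real-exponent pencil of
`stub_prescribedToPencil` has `≥ 20` positive zeros, contradicting `DoorA26` read over real exponents by
`Census.RealExp.theses_doorA26_iff_rpow`). [folklore] -/
theorem not_doorA26_of_prescribedWitness (hW : PrescribedWitness 20) :
    ¬ Summit.ValiantsHypothesis.ValiantsHypothesis.Theses.LacunarySymmetroid.DoorA26 := by
  intro hD
  obtain ⟨δ, S, hS, h20⟩ := stub_prescribedToPencil 20 hW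
  have h19 := (theses_doorA26_iff_rpow.mp hD) δ S hS
  omega

/-- **Negation face, composition 2: a nineteen-root prescribed witness settles the register `ζ_sym(2,6) ≥ 19`**
(`¬ PosRootLawAt 2 6 18`, via `Census.RealExp.not_posRootLawAt_iff_all`). [folklore] -/
theorem not_posRootLawAt_2_6_18_of_prescribedWitness (hW : PrescribedWitness 19) : ¬ PosRootLawAt 2 6 18 := by
  obtain ⟨δ, S, hS, h19⟩ := stub_prescribedToPencil 19 hW
  exact (not_posRootLawAt_iff_all 2 6 18).mpr ⟨δ, S, hS, h19⟩

/-- Monotonicity of the register statements: `n` prescribed roots give `k ≤ n` prescribed roots (verbatim from the line file).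
[folklore] -/
theorem prescribedWitness_mono {n k : ℕ} (h : k ≤ n) : PrescribedWitness n → PrescribedWitness k := by
  rintro ⟨δ, M, r, hδ, hM, hM0, hr, hpos, hzero⟩
  refine ⟨δ, M, fun a => r (Fin.castLE h a), hδ, hM, hM0, ?_, fun a => hpos _, fun a => hzero _⟩
  intro a b hab
  apply hr
  rw [Fin.lt_def] at hab ⊢
  simpa using hab

/-- A twenty-root prescribed witness also settles the register (monotonicity). [folklore] -/
theorem not_posRootLawAt_2_6_18_of_prescribedWitness_twenty (hW : PrescribedWitness 20) : ¬ PosRootLawAt 2 6 18 :=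
  not_posRootLawAt_2_6_18_of_prescribedWitness (prescribedWitness_mono (by norm_num) hW)

end Summit.ValiantsHypothesis.ValiantsHypothesis.Theorems.LacunarySymmetroid.DoorA26.InverseDoor
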